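import Literature.Probability.RandomPlanarGeometry.HexParafermion
import Literature.Probability.RandomPlanarGeometry.HexSAW
import Literature.Probability.LatticeModels.TriangularLatticeProofs
import Literature.Probability.Percolation.TriLoopWinding
import HarnessLib

/-!
# Crux `SAWDevelopingMap.ObservableToSLE` (stmt-CriticalPhenomena-10472), line
`floor-ratio-restriction-bootstrap`: the floor rows of the canonical domain (`stub_canonicalTransfer`)

Landing target:
`Summits/CriticalPhenomena/SAWScalingLimit/Theorems/SAWDevelopingMapObservableToSLECanonicalTransferFloor.lean`
(`--supports stmt-CriticalPhenomena-10472`).  Companion of `…CanonicalTransferDictionary.lean`.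

For a floor domain `D` (flat floor `Im = h` near both marked points) the canonical discrete domain
`Ω_δ` of `HexSAW.lean` has, at the mesh parameters `δ` with `frac(2h/(√3 δ)) ∈ [1/3, 2/3)`, a
ONE-SIDED lowest row: down-faces `(x, 1)` whose two lower neighbours `(x, 0)`, `(x + e₀, 0)` lie on
or below the floor line, hanging below the up-faces `(x + e₁, 0)` of the first full row by a
vertical edge (PENDANT vertices of `Ω_δ`); otherwise the lowest row is a full zigzag entered from
below through the vertical floor mid-edges `{(x - e₁, 1), (x, 0)}` of the admissible world.  The
endpoint clause of `stub_canonicalTransfer` ("a honeycomb neighbour on or below the floor") lands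
in exactly these two cases:

* `im_smul_hexCenter` — heights of rescaled face centres, `Im(δ c_{(x,k)}) = δ (x₁ + (k+1)/3) √3/2`;
* `floor_neighbour_cases` = registered sub-goal `stub_canonicalTransfer_floorCases` — the endpoint
  clause forces `a = (x, 0)` above `(x - e₁, 1)` (full lowest row) or `a = (x, 1)` pendant;
* `floor_pendant_neighbour`, `floor_up_neighbour` — the pendant vertex's only neighbour above the
  floor is `(x + e₁, 0)`; the other neighbours of a bottom up-face are strictly higher;
* `finite_subtype_isPath_subset`, `sum_hexMidEdgeSAW_eq_sum_isPath`,
  `sum_pow_length_hexMidEdgeSAW_eq` — `Z_Λ(s_a,s_b)` as a finite sum of `x^{#vertices}` over the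
  honeycomb vertex paths inside `Λ` ("the same `x_c^{#vertices}` weight").
-/

noncomputable section

open scoped BigOperators Classical ENNReal
open MeasureTheory
open Literature.Probability.LatticeModels (HexVertex hexGraph hexCenter Site
  hexGraph_adj_iff_of_snd_eq_zero_holds not_hexGraph_adj_of_snd_eq_holds hexGraph_adj_iff_of_snd_eq_one)
open Literature.Probability.RandomPlanarGeometry
open Literature.Probability.RandomPlanarGeometry.SAW

namespace Summit.CriticalPhenomena.SAWScalingLimit.Theorems.ObservableToSLE.FloorRatio

/-! ### The floor rows of the honeycomb lattice -/

section Floor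

open Literature.Probability.Percolation (hexCenter_im)

/-- Height of a rescaled face centre: `Im(δ c_{(x,k)}) = δ (x₁ + (k+1)/3) (√3/2)`. [folklore] -/
theorem im_smul_hexCenter (δ : ℝ) (v : HexVertex) :
    ((δ : ℂ) * hexCenter v).im = δ * (((v.1 1 : ℝ) + ((v.2 : ℕ) + 1) / 3) * (Real.sqrt 3 / 2)) := by
  obtain ⟨x, k⟩ := v
  rw [Complex.mul_im, Complex.ofReal_re, Complex.ofReal_im, zero_mul, add_zero, hexCenter_im]

/-- **The neighbour below the floor.**  If a honeycomb vertex `a` strictly above the horizontal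
line `Im = h` has a neighbour `u` on or below it (the endpoint clause of `stub_canonicalTransfer`),
then either `a = (x, 0)` is an up-face and `u = (x - e₁, 1)` is the face vertically below it
(the vertical floor mid-edge `{(x - e₁, 1), (x, 0)}` of the admissible world), or `a = (x, 1)` is
a down-face and `u` is one of the two up-faces `(x, 0)`, `(x + e₀, 0)` of its own row (the
PENDANT case: then both of them are on or below the line, `im_smul_hexCenter`). [folklore] -/
theorem floor_neighbour_cases {h δ : ℝ} (hδ : 0 < δ) {a u : HexVertex} (hadj : hexGraph.Adj a u)
    (ha : h < ((δ : ℂ) * hexCenter a).im) (hu : ((δ : ℂ) * hexCenter u).im ≤ h) :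
    (a.2 = 0 ∧ u = (a.1 - Pi.single 1 1, 1)) ∨
      (a.2 = 1 ∧ (u = (a.1, 0) ∨ u = (a.1 + Pi.single 0 1, 0))) := by
  have hlt := hu.trans_lt ha
  rw [im_smul_hexCenter, im_smul_hexCenter, mul_lt_mul_iff_right₀ hδ,
    mul_lt_mul_iff_left₀ (by positivity : (0 : ℝ) < Real.sqrt 3 / 2)] at hlt
  obtain ⟨x, k⟩ := a
  obtain ⟨y, l⟩ := u
  fin_cases k
  · refine Or.inl ⟨rfl, ?_⟩
    fin_cases l
    · exact absurd hadj (not_hexGraph_adj_of_snd_eq_holds _ _ rfl)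
    · rcases (hexGraph_adj_iff_of_snd_eq_zero_holds x y).1 hadj with rfl | rfl | rfl
      · simp at hlt; linarith
      · simp at hlt; linarith
      · rfl
  · refine Or.inr ⟨rfl, ?_⟩
    fin_cases l
    · rcases (hexGraph_adj_iff_of_snd_eq_one x y).1 hadj with rfl | rfl | rfl
      · exact Or.inl rfl
      · exact Or.inr rfl
      · simp at hlt; linarith
    · exact absurd hadj (not_hexGraph_adj_of_snd_eq_holds _ _ rfl)

/-- **Pendant floor vertices.**  In the pendant case (`a = (x, 1)` with the up-faces of its row on
or below the line `Im = h`), the only neighbour of `a` strictly above the line is the up-face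
`(x + e₁, 0)` vertically above it: in a domain lying above the line, `a` hangs below
`(x + e₁, 0)` by the vertical edge `{(x, 1), (x + e₁, 0)}`. [folklore] -/
theorem floor_pendant_neighbour {h δ : ℝ} (hδ : 0 < δ) {x : Site 2} {w : HexVertex}
    (hx : ((δ : ℂ) * hexCenter (x, (0 : Fin 2))).im ≤ h) (hadj : hexGraph.Adj (x, (1 : Fin 2)) w)
    (hw : h < ((δ : ℂ) * hexCenter w).im) : w = (x + Pi.single 1 1, 0) := by
  have hlt := hx.trans_lt hw
  rw [im_smul_hexCenter, im_smul_hexCenter, mul_lt_mul_iff_right₀ hδ,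
    mul_lt_mul_iff_left₀ (by positivity : (0 : ℝ) < Real.sqrt 3 / 2)] at hlt
  obtain ⟨y, l⟩ := w
  fin_cases l
  · rcases (hexGraph_adj_iff_of_snd_eq_one x y).1 hadj with rfl | rfl | rfl
    · simp at hlt
    · simp at hlt
    · rfl
  · exact absurd hadj (not_hexGraph_adj_of_snd_eq_holds _ _ rfl)

/-- **Bottom-row up-faces.**  In the non-pendant case (`a = (x, 0)` with `(x - e₁, 1)` on or below
the line `Im = h`), every other neighbour of `a` lies strictly above `a`; so `a` is a vertex of
the lowest row of any domain above the line, entered from below through the vertical floor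
mid-edge `{(x - e₁, 1), (x, 0)}`. [folklore] -/
theorem floor_up_neighbour (δ : ℝ) (hδ : 0 < δ) {x : Site 2} {w : HexVertex}
    (hadj : hexGraph.Adj (x, (0 : Fin 2)) w) (hw : w ≠ (x - Pi.single 1 1, 1)) :
    ((δ : ℂ) * hexCenter (x, (0 : Fin 2))).im < ((δ : ℂ) * hexCenter w).im := by
  rw [im_smul_hexCenter, im_smul_hexCenter, mul_lt_mul_iff_right₀ hδ,
    mul_lt_mul_iff_left₀ (by positivity : (0 : ℝ) < Real.sqrt 3 / 2)]
  obtain ⟨y, l⟩ := w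
  fin_cases l
  · exact absurd hadj (not_hexGraph_adj_of_snd_eq_holds _ _ rfl)
  · rcases (hexGraph_adj_iff_of_snd_eq_zero_holds x y).1 hadj with rfl | rfl | rfl
    · simp; norm_num
    · simp; norm_num
    · exact absurd rfl hw

end Floor

/-! ### Local copy of the dictionary bijection -/

section LocalCopies

variable {Λ : Finset HexVertex} {va ua vb ub : HexVertex}

/-- Local copy of `eq_of_mem_sym2_of_mem_loc` (`…CanonicalTransferDictionary.lean`), kept private. [folklore] -/
private theorem eq_of_mem_sym2_of_mem_loc {v u w : HexVertex} (hu : u ∉ Λ) (hw : w ∈ Λ)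
    (h : w ∈ s(v, u)) : w = v := by
  rcases Sym2.mem_iff.1 h with rfl | rfl
  · rfl
  · exact absurd hw hu

/-- Local copy of `exists_equiv_isPath_hexMidEdgeSAW_loc` (`…CanonicalTransferDictionary.lean`), kept private. [folklore] -/
private theorem exists_equiv_isPath_hexMidEdgeSAW_loc (hva : va ∈ Λ) (hua : ua ∉ Λ) (hub : ub ∉ Λ)
    (ha : hexGraph.Adj va ua) (hne : s(va, ua) ≠ s(vb, ub)) :
    ∃ e : {p : hexGraph.Walk va vb // p.IsPath ∧ ∀ w ∈ p.support, w ∈ Λ} ≃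
        HexMidEdgeSAW Λ s(va, ua) s(vb, ub), ∀ p, (e p).verts = p.1.support := by
  -- the forward map: a path is the mid-edge walk with the same vertex list
  let F : {p : hexGraph.Walk va vb // p.IsPath ∧ ∀ w ∈ p.support, w ∈ Λ} →
      HexMidEdgeSAW Λ s(va, ua) s(vb, ub) := fun p =>
    { verts := p.1.support
      subset := p.2.2
      nodup := p.2.1.support_nodup
      isChain := p.1.isChain_adj_support
      head_mem := fun v hv => by
        rw [List.head?_eq_some_iff] at hv
        obtain ⟨l, hl⟩ := hv
        have : p.1.support.head p.1.support_ne_nil = v := by simp [hl]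
        rw [SimpleGraph.Walk.head_support] at this
        exact this ▸ Sym2.mem_mk_left _ _
      getLast_mem := fun v hv => by
        rw [List.getLast?_eq_some_getLast p.1.support_ne_nil, Option.some_inj,
          SimpleGraph.Walk.getLast_support] at hv
        exact hv ▸ Sym2.mem_mk_left _ _
      eq_of_nil := fun h => absurd h p.1.support_ne_nil
      edges_nodup := fun _ => by
        rw [← SimpleGraph.Walk.edges_eq_zipWith_support, List.cons_append, List.nodup_cons,
          List.mem_append, List.mem_singleton, not_or]
        refine ⟨⟨fun h => hua (p.2.2 _ (p.1.snd_mem_support_of_mem_edges h)), hne⟩, ?_⟩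
        rw [List.nodup_append]
        refine ⟨p.2.1.isTrail.edges_nodup, List.nodup_singleton _, ?_⟩
        rintro e he _ h rfl
        rw [List.mem_singleton] at h
        subst h
        exact hub (p.2.2 _ (p.1.snd_mem_support_of_mem_edges he))
      fst_mem := ⟨(SimpleGraph.mem_edgeSet hexGraph).2 ha, va, Sym2.mem_mk_left _ _, hva⟩ }
  have hF : ∀ p, (F p).verts = p.1.support := fun _ => rfl
  have hinj : Function.Injective F := fun p q h =>
    Subtype.ext (SimpleGraph.Walk.ext_support (by rw [← hF, ← hF, h]))
  have hsurj : Function.Surjective F := by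
    intro γ
    have hne' : γ.verts ≠ [] := fun h => hne (γ.eq_of_nil h)
    have hhead : γ.verts.head hne' = va :=
      eq_of_mem_sym2_of_mem_loc hua (γ.subset _ (List.head_mem hne'))
        (γ.head_mem _ (List.head?_eq_some_head hne'))
    have hlast : γ.verts.getLast hne' = vb :=
      eq_of_mem_sym2_of_mem_loc hub (γ.subset _ (List.getLast_mem hne'))
        (γ.getLast_mem _ (List.getLast?_eq_some_getLast hne'))
    let p : hexGraph.Walk va vb :=
      (SimpleGraph.Walk.ofSupport γ.verts hne' γ.isChain).copy hhead hlast
    have hp : p.support = γ.verts := by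
      simp only [p, SimpleGraph.Walk.support_copy, SimpleGraph.Walk.support_ofSupport]
    refine ⟨⟨p, (SimpleGraph.Walk.isPath_def p).2 (hp ▸ γ.nodup), fun w hw => γ.subset w (hp ▸ hw)⟩,
      HexMidEdgeSAW.ext ?_⟩
    rw [hF, hp]
  exact ⟨Equiv.ofBijective F ⟨hinj, hsurj⟩, fun p => hF p⟩

end LocalCopies

/-! ### Finiteness and sums of vertex paths inside `Λ` -/

section Paths

variable {Λ : Finset HexVertex} {va ua vb ub : HexVertex}

/-- The self-avoiding vertex paths of `ℍ` between two vertices that stay inside a finite vertex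
set `Λ` form a finite set (they inject into the duplicate-free lists over `Λ`). [folklore] -/
theorem finite_subtype_isPath_subset (Λ : Finset HexVertex) (u v : HexVertex) :
    Finite {p : hexGraph.Walk u v // p.IsPath ∧ ∀ w ∈ p.support, w ∈ Λ} := by
  refine Finite.of_injective
    (fun p => (⟨p.1.support.attachWith (· ∈ Λ) p.2.2, ?_⟩ : {l : List ↥Λ // l.Nodup})) ?_
  · refine List.Nodup.of_map Subtype.val ?_
    rw [List.attachWith_map_subtype_val]
    exact p.2.1.support_nodup
  · intro p q h
    have h' := congrArg (fun l : {l : List ↥Λ // l.Nodup} => l.1.map Subtype.val) h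
    simp only [List.attachWith_map_subtype_val] at h'
    exact Subtype.ext (SimpleGraph.Walk.ext_support h')

/-- **Partition functions through the dictionary.**  For distinct boundary mid-edges
`s_a = {v_a, u_a}`, `s_b = {v_b, u_b}` of `Λ` and any function `f` of the vertex list, the sum of
`f` over the mid-edge walks `s_a → s_b` in `Λ` equals the sum of `f ∘ support` over the
self-avoiding vertex paths `v_a → v_b` inside `Λ`. [cite: DuminilCopinSmirnov2012, §1–§2 (walks between mid-edges)] -/
theorem sum_hexMidEdgeSAW_eq_sum_isPath {M : Type*} [AddCommMonoid M] (hva : va ∈ Λ)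
    (hua : ua ∉ Λ) (hub : ub ∉ Λ) (ha : hexGraph.Adj va ua) (hne : s(va, ua) ≠ s(vb, ub))
    [Fintype {p : hexGraph.Walk va vb // p.IsPath ∧ ∀ w ∈ p.support, w ∈ Λ}]
    (f : List HexVertex → M) :
    ∑ γ : HexMidEdgeSAW Λ s(va, ua) s(vb, ub), f γ.verts =
      ∑ p : {p : hexGraph.Walk va vb // p.IsPath ∧ ∀ w ∈ p.support, w ∈ Λ}, f p.1.support := by
  obtain ⟨e, he⟩ := exists_equiv_isPath_hexMidEdgeSAW_loc hva hua hub ha hne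
  rw [← e.sum_comp]
  exact Fintype.sum_congr _ _ fun p => by rw [he]

/-- In particular `Z_Λ(s_a, s_b) = Σ_γ x^{ℓ(γ)}` is the sum of `x^{#vertices}` over the
self-avoiding vertex paths `v_a → v_b` inside `Λ` ("the same `x_c^{#vertices}` weight").
[cite: DuminilCopinSmirnov2012, §1–§2 (walks between mid-edges)] -/
theorem sum_pow_length_hexMidEdgeSAW_eq (hva : va ∈ Λ) (hua : ua ∉ Λ) (hub : ub ∉ Λ)
    (ha : hexGraph.Adj va ua) (hne : s(va, ua) ≠ s(vb, ub))
    [Fintype {p : hexGraph.Walk va vb // p.IsPath ∧ ∀ w ∈ p.support, w ∈ Λ}] (x : ℝ) :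
    ∑ γ : HexMidEdgeSAW Λ s(va, ua) s(vb, ub), x ^ γ.length =
      ∑ p : {p : hexGraph.Walk va vb // p.IsPath ∧ ∀ w ∈ p.support, w ∈ Λ},
        x ^ (p.1.length + 1) := by
  have h := sum_hexMidEdgeSAW_eq_sum_isPath hva hua hub ha hne (fun l => x ^ l.length)
  simp only [SimpleGraph.Walk.length_support] at h
  exact h

end Paths


/-! ### Registered form: the two floor cases (sub-goal of `stub_canonicalTransfer`) -/

/-- **Registered sub-goal `stub_canonicalTransfer_floorCases`** (crux item stmt-CriticalPhenomena-10472,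
line `floor-ratio-restriction-bootstrap`, stub `stub_canonicalTransfer`): the endpoint clause of
`stub_canonicalTransfer` (a honeycomb neighbour `u` of `a` on or below the floor line `Im = h`,
`a` strictly above it) forces the two cases of the dictionary — `a = (x, 0)` with
`u = (x - e₁, 1)` (vertical floor mid-edge), or `a = (x, 1)` pendant with `u` an up-face of its
own row (registry form of `floor_neighbour_cases`). [folklore] -/
theorem stub_canonicalTransfer_floorCases :
    ∀ (h δ : ℝ) (a u : HexVertex), 0 < δ → hexGraph.Adj a u → h < ((δ : ℂ) * hexCenter a).im →
    ((δ : ℂ) * hexCenter u).im ≤ h →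
    (a.2 = 0 ∧ u = (a.1 - Pi.single 1 1, 1)) ∨
      (a.2 = 1 ∧ (u = (a.1, 0) ∨ u = (a.1 + Pi.single 0 1, 0))) :=
  fun _ _ _ _ hδ hadj ha hu => floor_neighbour_cases hδ hadj ha hu

end Summit.CriticalPhenomena.SAWScalingLimit.Theorems.ObservableToSLE.FloorRatio

end
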